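import Summits.ABC.IUTFork.Cor312VolumesSummandsBridge
import Summits.ABC.IUTFork.Cor312VolumesRealFrames
import Summits.ABC.IUTFork.Cor312LogKummerRoute
import HarnessLib

/-!
# [IUTchIII] Cor. 3.12, verbatim containers: the (Ind3)-UNION of coordinate-separated product images is NOT
# admissible — the negative twin of the `m`-constant dischargers of `hθ`

PROOF-ONLY support piece of the abc-iut cell (seat abc-iut-w5-d060, WAVE-5; follow-up of the RQ7 census note N1
on p415228 `Cor312TeamBCapstoneSummandsConst` / p415263, HOME/STATUS 2026-08-26T01:14Z; announced 01:3xZ with first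
refusal to abc-iut-c312-5 / abc-iut-c312-3 / abc-iut-c312-11). TAKES NO SIDE on [IUTchIII] Cor. 3.12.

In BOTH verbatim weighted containers of record a region of a tensor packet is ADMISSIBLE iff its image under the
(surjective) comparison map is a BOX: abc-iut-c312-5's `SummandPieces.Adm` ("a direct product of compact subsets
of positive measure in each of the direct summands", [IUTchIII] Rmk. 3.1.1 (iii) p. 95 l. 28–30) and the gen-2
`FrameVolumePieces.Adm` (boxes over the field factors). The typed bridge hypothesis `BridgeHyps.image_adm`
(abc-iut-c312-6, `Cor312StatementBridge`) asks EVERY possible image of the Θ-pilot — in particular the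
(Ind3)-enlarged region `P.thetaRegion3 = ⋃_m P.thetaRegion m` itself (`thetaRegion3_mem_possibleImages`) — to be
admissible; abc-iut-c312-5's `bridgeHyps_of_summands` / `Real.bridgeHyps_DH` / `bridgeHyps_settingDHVol` carry
exactly this as the named residual `hθ`.

* p415228 (abc-iut-w5-d235) discharges `hθ` when the Kummer images are `m`-CONSTANT (the (Ind3)-idle /
  Dupuy–Hilado single-region reading).
* §4 extends the positive side slightly: NESTED families with an attained maximum (`thetaRegion3_eq_of_max`,
  `thetaRegion3_adm_of_max`).
* THIS FILE proves the complementary NEGATIVE: if at ONE packet two members `P.thetaRegion m₁ ∋ x₁`,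
  `P.thetaRegion m₂ ∋ x₂` of a family of product images are SEPARATED at two distinct coordinates `e₁ ≠ e₂`
  (no member box contains both the `e₁`-coordinate of `x₁` and the `e₂`-coordinate of `x₂`), then the union is
  not a box (`not_exists_image_iUnion_eq_pi`: the mixed point `update (f x₁) e₂ (f x₂ e₂)` lies in every
  candidate box but in no member), hence NOT admissible in either container (`SummandPieces.not_adm_iUnion`,
  `FrameVolumePieces.not_adm_iUnion`), hence `hθ` FAILS and so does `BridgeHyps`
  (`SummandPieces.not_bridgeHyps_of_separated`, `FrameVolumePieces.not_bridgeHyps_of_separated`).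

Reading (neutral): over the typed containers the residual `hθ` — hence `BridgeHyps` — forces, at every packet with
`≥ 2` summands, a family of Θ-images in which ANY coordinate of ANY member is realized TOGETHER with any other
coordinate of any other member inside a single member box (e.g. `m`-constant families, p415228, or nested ones with
attained union); an honest `m`-VARYING reading with incomparable product images at such a packet — e.g. a depth-`0` image with a UNIT coordinate against a depth-`1` image
`∋ 0` at another summand, cf. the log-link iterate census of abc-iut-w4-d029 / abc-iut-w5-d172 — is EXCLUDED by
`BridgeHyps` itself. The printed proof only ever takes the holomorphic HULL of the union (p. 174 l. 50–58), which
is admissible by construction; nothing here bears on the print. Pure set theory; NO definition, NO `Prop` fact,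
nothing of [IUTchIII] asserted. [claim: Mochizuki2012, status: disputed] for the Corollary's vocabulary only.
-/

noncomputable section

open Set

namespace Summit.ABC

namespace IUTFork

namespace Cor312Vol

open Thm311 Cor312 Literature.IUT.LogVolume Literature.IUT.LogThetaLattice

/-! ## 1. Set theory: a union of coordinate-separated boxes is not a box -/

/-- **A union of coordinate-separated boxes is not a box.** For a map `f : α → Π_e X_e` and a family `A_m`
whose images are boxes `f '' A_m = Π_e R_{m,e}`: if members `A_{m₁} ∋ x₁`, `A_{m₂} ∋ x₂` are separated at two
distinct coordinates `e₁ ≠ e₂` — no member box contains both `(f x₁)_{e₁}` and `(f x₂)_{e₂}` — then the image of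
`⋃_m A_m` is not a box: the mixed point agreeing with `f x₁` off `e₂` and with `f x₂` at `e₂` would lie in it but
lies in no member. [folklore] -/
theorem not_exists_image_iUnion_eq_pi {α E : Type*} {X : E → Type*} (f : α → ∀ e, X e)
    {ι : Sort*} {A : ι → Set α} {R : ι → ∀ e, Set (X e)}
    (hbox : ∀ m, f '' A m = Set.pi univ (R m)) {m₁ m₂ : ι} {x₁ x₂ : α} (hx₁ : x₁ ∈ A m₁)
    (hx₂ : x₂ ∈ A m₂) {e₁ e₂ : E} (hne : e₁ ≠ e₂)
    (hsep : ∀ m, f x₁ e₁ ∈ R m e₁ → f x₂ e₂ ∉ R m e₂) :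
    ¬ ∃ S : ∀ e, Set (X e), f '' (⋃ m, A m) = Set.pi univ S := by
  classical
  rintro ⟨S, hS⟩
  -- both sample points map into the candidate box
  have h1 : f x₁ ∈ Set.pi univ S := hS ▸ Set.mem_image_of_mem f (Set.mem_iUnion.2 ⟨m₁, hx₁⟩)
  have h2 : f x₂ ∈ Set.pi univ S := hS ▸ Set.mem_image_of_mem f (Set.mem_iUnion.2 ⟨m₂, hx₂⟩)
  -- hence so does the mixed point
  set y : ∀ e, X e := Function.update (f x₁) e₂ (f x₂ e₂) with hy
  have hyS : y ∈ Set.pi univ S := by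
    intro e _
    by_cases he : e = e₂
    · subst he
      rw [hy, Function.update_self]
      exact h2 e (Set.mem_univ _)
    · rw [hy, Function.update_of_ne he]
      exact h1 e (Set.mem_univ _)
  -- so it lies in some member box, contradicting the separation
  rw [← hS, Set.image_iUnion] at hyS
  obtain ⟨m, hm⟩ := Set.mem_iUnion.1 hyS
  rw [hbox m] at hm
  have he₁ : y e₁ = f x₁ e₁ := by rw [hy, Function.update_of_ne hne]
  have he₂ : y e₂ = f x₂ e₂ := by rw [hy, Function.update_self]
  exact hsep m (he₁ ▸ hm e₁ (Set.mem_univ _)) (he₂ ▸ hm e₂ (Set.mem_univ _))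

/-- Sanity instance (the hypotheses are met non-degenerately): over two Boolean coordinates the singletons
`{(true,true)}` and `{(false,false)}` are boxes, separated at the two coordinates, and their union — the
"diagonal" — is not a box. [folklore] -/
example : ¬ ∃ S : Bool → Set Bool,
    (id : (Bool → Bool) → Bool → Bool) '' (⋃ b : Bool, {fun _ => b}) = Set.pi univ S :=
  not_exists_image_iUnion_eq_pi (E := Bool) (X := fun _ => Bool) id (A := fun b : Bool => {fun _ => b})
    (R := fun b _ => {b})
    (fun b => by
      rw [Set.image_id]
      ext g
      simp only [Set.mem_singleton_iff, Set.mem_univ_pi]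
      exact ⟨fun h e => h ▸ rfl, fun h => funext fun e => h e⟩)
    (m₁ := true) (m₂ := false) rfl rfl (e₁ := true) (e₂ := false) (by decide)
    (fun b h h' => by
      simp only [id, Set.mem_singleton_iff] at h h'
      exact Bool.noConfusion (h.trans h'.symm))

variable {T : ThetaIndex}

/-! ## 2. The summandwise container (abc-iut-c312-5 `SummandPieces`) -/

namespace SummandPieces

variable {L : LogShells T} {V : SummandPieces L} {j : T.Label} {vQ : T.VQ}

/-- **Not admissible in the verbatim summandwise container**: a union of regions whose images are direct
product regions over the summands, two of which are coordinate-separated at distinct summands `e₁ ≠ e₂`, is not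
a direct product region ([IUTchIII] Rmk. 3.1.1 (iii) p. 95: admissible = "a direct product of compact subsets
of positive measure in each of the direct summands"). [claim: Mochizuki2012, status: disputed] -/
theorem not_adm_iUnion {ι : Sort*} {A : ι → Set (L.Packet j vQ)} {R : ι → ∀ e, Set (V.X j vQ e)}
    (hbox : ∀ m, V.e j vQ '' A m = Set.pi univ (R m)) {m₁ m₂ : ι} {x₁ x₂ : L.Packet j vQ}
    (hx₁ : x₁ ∈ A m₁) (hx₂ : x₂ ∈ A m₂) {e₁ e₂ : V.E j vQ} (hne : e₁ ≠ e₂)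
    (hsep : ∀ m, V.e j vQ x₁ e₁ ∈ R m e₁ → V.e j vQ x₂ e₂ ∉ R m e₂) :
    ¬ V.Adm j vQ (⋃ m, A m) := fun ⟨S, hS, _⟩ =>
  not_exists_image_iUnion_eq_pi (V.e j vQ) hbox hx₁ hx₂ hne hsep ⟨S, hS⟩

/-- The same with the member images given as ADMISSIBLE regions (their factors are then the boxes).
[claim: Mochizuki2012, status: disputed] -/
theorem not_adm_iUnion_of_adm {ι : Sort*} {A : ι → Set (L.Packet j vQ)} (hadm : ∀ m, V.Adm j vQ (A m))
    {m₁ m₂ : ι} {x₁ x₂ : L.Packet j vQ} (hx₁ : x₁ ∈ A m₁) (hx₂ : x₂ ∈ A m₂) {e₁ e₂ : V.E j vQ}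
    (hne : e₁ ≠ e₂)
    (hsep : ∀ m, V.e j vQ x₁ e₁ ∈ V.factor j vQ (A m) e₁ → V.e j vQ x₂ e₂ ∉ V.factor j vQ (A m) e₂) :
    ¬ V.Adm j vQ (⋃ m, A m) :=
  not_adm_iUnion (R := fun m => V.factor j vQ (A m)) (fun m => (Adm.pi_factor (hadm m)).1) hx₁ hx₂ hne hsep

end SummandPieces

namespace SummandPieces

variable {S : Situation T} {V : SummandPieces S.L} {P : Cor312.Setting S} {j : T.Label} {vQ : T.VQ}

/-- **`hθ` FAILS for coordinate-separated `m`-varying Kummer images.** Over a situation whose container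
realizes `V`, if at the packet `(j, v_ℚ)` the Θ-Kummer images `P.thetaRegion m` have box images and two of them
are separated at distinct summands, then the (Ind3)-enlarged region `P.thetaRegion3 j v_ℚ = ⋃_m P.thetaRegion m`
(Cor. 3.12 p. 173 l. 43 "the union of the possible images") is NOT admissible. Negative twin of
abc-iut-w5-d235's `Setting.thetaRegion3_adm_of_mConst`. [claim: Mochizuki2012, status: disputed] -/
theorem not_adm_thetaRegion3_of_separated (hV : V.Realizes (S.D P.n)) {R : ℤ → ∀ e, Set (V.X j vQ e)}
    (hbox : ∀ m : ℤ, V.e j vQ '' P.thetaRegion m j vQ = Set.pi univ (R m)) {m₁ m₂ : ℤ}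
    {x₁ x₂ : S.L.Packet j vQ} (hx₁ : x₁ ∈ P.thetaRegion m₁ j vQ) (hx₂ : x₂ ∈ P.thetaRegion m₂ j vQ)
    {e₁ e₂ : V.E j vQ} (hne : e₁ ≠ e₂)
    (hsep : ∀ m : ℤ, V.e j vQ x₁ e₁ ∈ R m e₁ → V.e j vQ x₂ e₂ ∉ R m e₂) :
    ¬ (S.D P.n).Adm j vQ (P.thetaRegion3 j vQ) := by
  rw [hV.adm_iff]
  exact not_adm_iUnion hbox hx₁ hx₂ hne hsep

/-- **`BridgeHyps` FAILS for coordinate-separated `m`-varying Kummer images at a label in `𝔽_l^⋇`**: the typed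
bridge hypothesis `image_adm` (every possible image admissible) contains `hθ` at the (Ind3)-union itself
(`thetaRegion3_mem_possibleImages`). So every setting over the summandwise container that satisfies `BridgeHyps`
has, at every multi-summand packet, NO two coordinate-separated Θ-images (e.g. `m`-constant or nested families
pass; incomparable product images do not). [claim: Mochizuki2012, status: disputed] -/
theorem not_bridgeHyps_of_separated (hV : V.Realizes (S.D P.n)) {i : Fin T.lstar} {vQ : T.VQ}
    {R : ℤ → ∀ e, Set (V.X (Setting.labelSucc i) vQ e)}
    (hbox : ∀ m : ℤ, V.e _ vQ '' P.thetaRegion m (Setting.labelSucc i) vQ = Set.pi univ (R m)) {m₁ m₂ : ℤ}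
    {x₁ x₂ : S.L.Packet (Setting.labelSucc i) vQ} (hx₁ : x₁ ∈ P.thetaRegion m₁ (Setting.labelSucc i) vQ)
    (hx₂ : x₂ ∈ P.thetaRegion m₂ (Setting.labelSucc i) vQ) {e₁ e₂ : V.E (Setting.labelSucc i) vQ}
    (hne : e₁ ≠ e₂) (hsep : ∀ m : ℤ, V.e _ vQ x₁ e₁ ∈ R m e₁ → V.e _ vQ x₂ e₂ ∉ R m e₂) :
    ¬ BridgeHyps P := fun H =>
  not_adm_thetaRegion3_of_separated hV hbox hx₁ hx₂ hne hsep
    (H.image_adm i vQ _ (P.thetaRegion3_mem_possibleImages _ vQ))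

end SummandPieces

/-! ## 3. The field-factor container (`FrameVolumePieces`, settings `Setting.ofFrames`) -/

namespace FrameVolumePieces

variable {L : LogShells T} {V : FrameVolumePieces L} {j : T.Label} {vQ : T.VQ}

/-- **Not admissible in the field-factor container**: a union of regions with box images over the field
factors, two of which are coordinate-separated at distinct factors, is not box-admissible.
[claim: Mochizuki2012, status: disputed] -/
theorem not_adm_iUnion {ι : Sort*} {A : ι → Set (L.Packet j vQ)} {R : ι → ∀ k, Set (V.K j vQ k)}
    (hbox : ∀ m, V.e j vQ '' A m = Set.pi univ (R m)) {m₁ m₂ : ι} {x₁ x₂ : L.Packet j vQ}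
    (hx₁ : x₁ ∈ A m₁) (hx₂ : x₂ ∈ A m₂) {k₁ k₂ : V.J j vQ} (hne : k₁ ≠ k₂)
    (hsep : ∀ m, V.e j vQ x₁ k₁ ∈ R m k₁ → V.e j vQ x₂ k₂ ∉ R m k₂) :
    ¬ V.Adm j vQ (⋃ m, A m) := fun ⟨S, hS, _⟩ =>
  not_exists_image_iUnion_eq_pi (V.e j vQ) hbox hx₁ hx₂ hne hsep ⟨S, hS⟩

end FrameVolumePieces

namespace FrameVolumePieces

variable {S : Situation T} {V : FrameVolumePieces S.L} {P : Cor312.Setting S} {j : T.Label} {vQ : T.VQ}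

/-- **`hθ` FAILS at the frames-type containers for coordinate-separated `m`-varying Kummer images** (e.g. the
Θ-boxes `e⁻¹(thetaBox m …)` of `Setting.ofFrames` when two of them are hull-type boxes separated at two field
factors). Negative twin of abc-iut-w5-d235's `thetaRegion3_adm_ofFrames_of_mConst_hullSet`.
[claim: Mochizuki2012, status: disputed] -/
theorem not_adm_thetaRegion3_of_separated (hV : V.Realizes (S.D P.n)) {R : ℤ → ∀ k, Set (V.K j vQ k)}
    (hbox : ∀ m : ℤ, V.e j vQ '' P.thetaRegion m j vQ = Set.pi univ (R m)) {m₁ m₂ : ℤ}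
    {x₁ x₂ : S.L.Packet j vQ} (hx₁ : x₁ ∈ P.thetaRegion m₁ j vQ) (hx₂ : x₂ ∈ P.thetaRegion m₂ j vQ)
    {k₁ k₂ : V.J j vQ} (hne : k₁ ≠ k₂)
    (hsep : ∀ m : ℤ, V.e j vQ x₁ k₁ ∈ R m k₁ → V.e j vQ x₂ k₂ ∉ R m k₂) :
    ¬ (S.D P.n).Adm j vQ (P.thetaRegion3 j vQ) := by
  rw [hV.adm_iff]
  exact not_adm_iUnion hbox hx₁ hx₂ hne hsep

/-- **`BridgeHyps` FAILS at the frames-type containers for coordinate-separated `m`-varying Kummer images at a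
label in `𝔽_l^⋇`.** [claim: Mochizuki2012, status: disputed] -/
theorem not_bridgeHyps_of_separated (hV : V.Realizes (S.D P.n)) {i : Fin T.lstar} {vQ : T.VQ}
    {R : ℤ → ∀ k, Set (V.K (Setting.labelSucc i) vQ k)}
    (hbox : ∀ m : ℤ, V.e _ vQ '' P.thetaRegion m (Setting.labelSucc i) vQ = Set.pi univ (R m)) {m₁ m₂ : ℤ}
    {x₁ x₂ : S.L.Packet (Setting.labelSucc i) vQ} (hx₁ : x₁ ∈ P.thetaRegion m₁ (Setting.labelSucc i) vQ)
    (hx₂ : x₂ ∈ P.thetaRegion m₂ (Setting.labelSucc i) vQ) {k₁ k₂ : V.J (Setting.labelSucc i) vQ}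
    (hne : k₁ ≠ k₂) (hsep : ∀ m : ℤ, V.e _ vQ x₁ k₁ ∈ R m k₁ → V.e _ vQ x₂ k₂ ∉ R m k₂) :
    ¬ BridgeHyps P := fun H =>
  not_adm_thetaRegion3_of_separated hV hbox hx₁ hx₂ hne hsep
    (H.image_adm i vQ _ (P.thetaRegion3_mem_possibleImages _ vQ))

end FrameVolumePieces

/-! ## 4. The positive side beyond `m`-constancy: nested families with an attained maximum -/

section Nested

variable {S : Situation T} (P : Cor312.Setting S)

/-- If at `(j, v_ℚ)` every Θ-Kummer image is contained in the one at position `m₀` (a NESTED family with attained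
maximum — e.g. the `m`-constant families of p415228), the (Ind3)-union IS that image. [folklore] -/
theorem _root_.Summit.ABC.IUTFork.Cor312.Setting.thetaRegion3_eq_of_max {m₀ : ℤ} (j : T.Label) (vQ : T.VQ)
    (hmax : ∀ m : ℤ, P.thetaRegion m j vQ ⊆ P.thetaRegion m₀ j vQ) :
    P.thetaRegion3 j vQ = P.thetaRegion m₀ j vQ :=
  subset_antisymm (Set.iUnion_subset hmax) (Set.subset_iUnion (fun m : ℤ => P.thetaRegion m j vQ) m₀)

/-- **`hθ` for nested families with an attained maximum**: then the residual "the (Ind3)-union is admissible"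
follows from the admissibility of the single images (abc-iut-c312-11's `ThetaRegionsAdm`, Thm. 3.11 (ii) (a)) —
the positive bracket matching `not_bridgeHyps_of_separated`. [claim: Mochizuki2012, status: disputed] -/
theorem _root_.Summit.ABC.IUTFork.Cor312.Setting.thetaRegion3_adm_of_max (m₀ : Fin T.lstar → T.VQ → ℤ)
    (hmax : ∀ (i : Fin T.lstar) (vQ : T.VQ) (m : ℤ),
      P.thetaRegion m (Setting.labelSucc i) vQ ⊆ P.thetaRegion (m₀ i vQ) (Setting.labelSucc i) vQ)
    (hadm : ThetaRegionsAdm P) (i : Fin T.lstar) (vQ : T.VQ) :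
    (S.D P.n).Adm _ vQ (P.thetaRegion3 (Setting.labelSucc i) vQ) := by
  rw [P.thetaRegion3_eq_of_max _ vQ (hmax i vQ)]
  exact hadm (m₀ i vQ) i vQ

end Nested

end Cor312Vol

end IUTFork

end Summit.ABC

end
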